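import Summits.BirchSwinnertonDyer.Rank1Residual.Additive.DisegniLinePointwise
import Summits.BirchSwinnertonDyer.Rank1Residual.Additive.DisegniLineValuesOdd
import HarnessLib

/-!
# STEP B⁻(1) (odd branch, `p ≡ 3 (mod 4)`): Disegni's line function at the twin point of a typed
# character is `c⁻ · v⁻_f · v⁻_{f′}` (cell `bsd-addord`, seat `bsd-addord-gz` gen 4)

HONEST FRAMING (cell `bsd-addord`; PARTITION (D-0054): EXCLUDED-DOMAIN additive rows §E, B6 = O7-ord r1 ×
every consumer of hFact, rows `p ≡ 3 (mod 4)` — types-the-object-of; booked 0). THEOREMS ONLY. Odd twin of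
`DisegniLinePointwise` §2: the Artin-formalism step (coefficient relations `a_n(f_E) = (n/p)a_n(f)`,
`a_n(f′) = κ(n)a_n(f)`, named fact `hArt` displayed) is parity-free and copied; the evaluation uses STEP A⁻
(`cycLineValue_eq_const_mul_minusBranchValues`, minus symbols, `c⁻ = ι⁻¹(−u·Car·Ω⁻_f·Ω⁻_{f′})`).

References: [Disegni2017] Thm. A (arXiv v3 PDF 7–8); [Gross2004] §3; [MazurTateTeitelbaum1986Invent]
§I.8 (8.6), §I.14 (14.3).
-/

set_option autoImplicit false

noncomputable section

open scoped Classical MatrixGroups ModularForm NumberField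

open CongruenceSubgroup WeierstrassCurve Literature.NumberTheory.EllipticCurves
  Literature.NumberTheory.EllipticCurves.ModularForms
  Literature.NumberTheory.EllipticCurves.Disegni2017 Literature.NumberTheory.GaloisRepresentations

namespace Summit.BirchSwinnertonDyer.Rank1Residual.Additive

section PointwiseOdd

variable {p : ℕ} [hp : Fact p.Prime] (ι : PadicAlgCl p ≃+* ℂ)
  (K : Type) [Field K] [NumberField K] [IsGalois ℚ K]

/-- **Disegni's line function at the twin point of a typed character, ODD branch** (`p ≡ 3 (mod 4)`): if `G`
satisfies Theorem A on the line (`CycLineInterpolation ι K fE α Car G`), then for every even `θ` mod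
`p^{m+1}` of `p`-power order, primitive unless `m = 0`,
`G(χ_θ(γ) − 1) = ι⁻¹(−u·Car·Ω⁻_f·Ω⁻_{f′}) · v⁻_f(χ_θ) · v⁻_{f′}(χ_θ)` (minus symbols) — Artin formalism (the named fact
`rankinSelbergEulerProductHecke_baseChangeDirichlet_eq`, DISPLAYED as `hArt`) identifies the Rankin–Selberg
Euler product of `f_E` over `K` along `θ∘N` with `L(f⊗θε)·L(f′⊗θε)` (§1), whose entire continuation we take
to be the product of the two continuations; STEP A⁻ evaluates Disegni's value there.
[cite: Disegni2017, Theorem A (arXiv v3 PDF 7–8)] [cite: Gross2004, §3 (p. 40), §13 (p. 49)]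
[cite: MazurTateTeitelbaum1986Invent, §I.14 (14.3)] -/
theorem hasLineValueAt_twin_of_cycLineInterpolation_odd (hp4 : p % 4 = 3)
    (hArt : rankinSelbergEulerProductHecke_baseChangeDirichlet_eq)
    (h2 : Module.finrank ℚ K = 2) (κ : DirichletCharacter ℂ (NumberField.discr K).natAbs)
    (hκ : ∀ ℓ : ℕ, ℓ.Prime → ℓ ≠ 2 → κ ℓ = (jacobiSym (NumberField.discr K) ℓ : ℂ))
    (hκ2 : κ 2 = if NumberField.discr K % 8 = 1 then 1
        else if NumberField.discr K % 8 = 5 then -1 else 0)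
    (hpd : Nat.Coprime p (NumberField.discr K).natAbs)
    {N NE N' : ℕ} [NeZero N] [NeZero NE] [NeZero N'] {f : CuspForm (Gamma0 N) 2}
    {fE : CuspForm (Gamma0 NE) 2} {f' : CuspForm (Gamma0 N') 2}
    (hfE : IsNewform0 fE) (hf : IsNewform0 f) (hQ : coeffField f = ⊥) (hf' : IsNewform0 f')
    (hQ' : coeffField f' = ⊥)
    (hE : ∀ n : ℕ, cuspCoeff fE n = (legendreSym p (n : ℤ) : ℂ) * cuspCoeff f n)
    (hV' : ∀ n : ℕ, cuspCoeff f' n = κ (n : ZMod (NumberField.discr K).natAbs) * cuspCoeff f n)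
    {α : ℚ_[p]} {Car : ℝ} {G : PowerSeries ℂ_[p]} (hG : CycLineInterpolation ι K fE α Car G)
    {m : ℕ} (hm : cyclotomicExponent p ≤ m + 1) (θ : DirichletCharacter ℂ (p ^ (m + 1)))
    (heven : θ.Even) (hord : ∃ j : ℕ, orderOf θ = p ^ j) (hprim : θ.IsPrimitive ∨ m = 0) :
    HasLineValueAt G
      (((θ⁻¹.ringHomComp ι.symm.toRingHom).ringHomComp (algebraMap (PadicAlgCl p) ℂ_[p]))
          (cyclotomicGenerator p : ZMod (p ^ (m + 1))) - 1)
      (((ι.symm (-(splitLocalConstant p : ℂ) * (Car : ℂ) * (minusPeriod f : ℂ) * (minusPeriod f' : ℂ)) :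
          PadicAlgCl p) : ℂ_[p]) *
        (algebraMap ℚ_[p] ℂ_[p] (α⁻¹ ^ (m + 1)) *
          ∑ b : ZMod (p ^ (m + 1)),
            ((θ⁻¹.ringHomComp ι.symm.toRingHom).ringHomComp (algebraMap (PadicAlgCl p) ℂ_[p])) b *
              algebraMap ℚ_[p] ℂ_[p] (teichWeight p (p / 2)
                (ZMod.castHom (pow_dvd_pow p hm) (ZMod (p ^ cyclotomicExponent p)) b)) *
              (ratMinusSymbol f ((b.val : ℚ) / ((p ^ (m + 1) : ℕ) : ℚ)) : ℂ_[p])) *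
        (algebraMap ℚ_[p] ℂ_[p] (α⁻¹ ^ (m + 1)) *
          ∑ b : ZMod (p ^ (m + 1)),
            ((θ⁻¹.ringHomComp ι.symm.toRingHom).ringHomComp (algebraMap (PadicAlgCl p) ℂ_[p])) b *
              algebraMap ℚ_[p] ℂ_[p] (teichWeight p (p / 2)
                (ZMod.castHom (pow_dvd_pow p hm) (ZMod (p ^ cyclotomicExponent p)) b)) *
              (ratMinusSymbol f' ((b.val : ℚ) / ((p ^ (m + 1) : ℕ) : ℚ)) : ℂ_[p]))) := by
  have hpP : p.Prime := hp.out
  have hp2 : p ≠ 2 := by intro h; rw [h] at hp4; norm_num at hp4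
  haveI : NeZero (NumberField.discr K).natAbs :=
    ⟨Int.natAbs_ne_zero.mpr (NumberField.discr_ne_zero K)⟩
  set ε := legendreLevel p (m + 1) (Nat.succ_ne_zero m) with hε
  -- the two continuations and their product
  obtain ⟨Λ₁, hΛ₁, hΛ₁'⟩ := exists_differentiable_eq_twistedLSeries_holds (f := f) (θ * ε)
  obtain ⟨Λ₂, hΛ₂, hΛ₂'⟩ := exists_differentiable_eq_twistedLSeries_holds (f := f') (θ * ε)
  have hΛ : Differentiable ℂ (fun s ↦ Λ₁ s * Λ₂ s) := hΛ₁.mul hΛ₂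
  -- Artin formalism: the product continues the Rankin–Selberg Euler product along `θ ∘ N`
  have hRS : ∀ s : ℂ, 2 < s.re →
      (fun s ↦ Λ₁ s * Λ₂ s) s = rankinSelbergEulerProductHecke fE (baseChangeDirichlet K θ) s := by
    intro s hs
    simp only
    rw [hΛ₁' s hs, hΛ₂' s hs, ← twistedLSeries_eq_of_coeff_legendre p hE θ s,
      ← twistedLSeries_mul_eq_of_coeff_kronecker p κ hE hV' θ s, baseChangeDirichlet_def]
    rcases Nat.eq_zero_or_pos m with hm0 | hmpos
    · -- `m = 0`: `θ = 1`, and the level-`p` trivial character agrees termwise with the level-`1` one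
      subst hm0
      have hθ1 : θ = 1 := eq_one_of_orderOf_eq_prime_pow_level_prime p hord
      subst hθ1
      haveI : NeZero (1 : ℕ) := ⟨one_ne_zero⟩
      have h1 := hArt K h2 κ hκ hκ2 fE hfE (1 : DirichletCharacter ℂ 1)
        DirichletCharacter.isPrimitive_one_level_one (Nat.coprime_one_left _) s hs
      rw [compRelNorm_ofDirichlet_one K] at h1
      rw [compRelNorm_ofDirichlet_one K, h1]
      -- the two sides are the same Dirichlet series termwise (`a_n(f_E) = 0` when `p ∣ n`)
      have hvan : ∀ n : ℕ, ¬ IsUnit ((n : ZMod (p ^ (0 + 1)))) → cuspCoeff fE n = 0 := by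
        intro n hn
        have hdvd : (p : ℤ) ∣ (n : ℤ) := by
          have hcop : ¬ Nat.Coprime n (p ^ (0 + 1)) := fun h ↦ hn ((ZMod.isUnit_iff_coprime n _).mpr h)
          rw [zero_add, pow_one, Nat.coprime_comm, hpP.coprime_iff_not_dvd, not_not] at hcop
          exact_mod_cast hcop
        have hz : ((n : ℤ) : ZMod p) = 0 := (ZMod.intCast_zmod_eq_zero_iff_dvd (n : ℤ) p).mpr hdvd
        have h0 : legendreSym p (n : ℤ) = 0 := (legendreSym.eq_zero_iff p (n : ℤ)).mpr hz
        rw [hE n, h0, Int.cast_zero, zero_mul]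
      have hone : ∀ n : ℕ, IsUnit ((n : ZMod (p ^ (0 + 1)))) →
          (1 : DirichletCharacter ℂ (p ^ (0 + 1))) (n : ZMod (p ^ (0 + 1))) = 1 :=
        fun n hn ↦ MulChar.one_apply hn
      have hone1 : ∀ n : ℕ, (1 : DirichletCharacter ℂ 1) (n : ZMod 1) = 1 :=
        fun n ↦ MulChar.one_apply (isUnit_of_subsingleton _)
      have hA : twistedLSeries fE (1 : DirichletCharacter ℂ 1) s =
          twistedLSeries fE (1 : DirichletCharacter ℂ (p ^ (0 + 1))) s := by
        unfold twistedLSeries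
        congr 1
        funext n
        by_cases hn : IsUnit ((n : ZMod (p ^ (0 + 1))))
        · rw [hone n hn, hone1 n]
        · rw [hvan n hn, mul_zero, mul_zero]
      have hB : twistedLSeries fE (DirichletCharacter.mul (1 : DirichletCharacter ℂ 1) κ) s =
          twistedLSeries fE (DirichletCharacter.mul (1 : DirichletCharacter ℂ (p ^ (0 + 1))) κ) s := by
        unfold twistedLSeries
        congr 1
        funext n
        rw [dirichletCharacter_mul_natCast, dirichletCharacter_mul_natCast, hone1 n]
        by_cases hn : IsUnit ((n : ZMod (p ^ (0 + 1))))
        · rw [hone n hn]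
        · rw [hvan n hn, mul_zero, mul_zero]
      rw [hA, hB]
    · have hθ : θ.IsPrimitive := hprim.resolve_right (by omega)
      exact (hArt K h2 κ hκ hκ2 fE hfE θ hθ (Nat.Coprime.pow_left _ hpd) s hs).symm
  -- Theorem A at `θ` with this continuation, then STEP A and the twin point
  have hval := hG.hasLineValueAt heven hord hprim hΛ hRS
  rw [cycLineValue_eq_const_mul_minusBranchValues ι hp4 hm θ heven hord hprim hf hQ hf' hQ' α Car hΛ₁ hΛ₁'
    hΛ₂ hΛ₂', ← twin_apply_cyclotomicGenerator_sub_one ι θ] at hval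
  exact hval

end PointwiseOdd

end Summit.BirchSwinnertonDyer.Rank1Residual.Additive

end
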